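import Mathlib.LinearAlgebra.Projection
import Mathlib.LinearAlgebra.Pi
import Mathlib.LinearAlgebra.Basis.VectorSpace
import Mathlib.LinearAlgebra.DFinsupp
import Mathlib.Algebra.BigOperators.Pi
import Mathlib.Algebra.Module.BigOperators
import Mathlib.Algebra.Group.Subgroup.Pointwise
import Mathlib.Algebra.Group.Units.Hom
import Mathlib.Data.Fintype.Perm
import Literature.NumberTheory.GaloisRepresentations.ArtinConductorIntegrality
import Literature.NumberTheory.Automorphic.SmoothRepresentation
import HarnessLib

/-!
# Fixed vectors of commuting finite group actions (Carlton's lemma, Diamond–Shurman Prop. 5.7.7)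

Topic `Literature/RepresentationTheory/FiniteGroups`. The representation-theoretic heart of
Carlton's proof of the **Main Lemma** of Atkin–Lehner theory (Diamond–Shurman, *A first course in
modular forms*, GTM 228, Thm. 5.7.1, third version Thm. 5.7.5 and (5.17), PDF pp. 211–215) is the
following statement about a representation `V` of a product of finite groups `G = ∏ᵢ Gᵢ` with
subgroups `Hᵢ, Kᵢ ≤ Gᵢ`, `H = ∏ Hᵢ` (Prop. 5.7.7, stated there for `V` irreducible):

`V^H ∩ ∑ᵢ V^{Kᵢ} = ∑ᵢ V^{⟨H, Kᵢ⟩}`.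

Diamond–Shurman deduce (5.17) for `V = S_k(Γ(N))` from the irreducible case by quoting complete
reducibility and the fact that an irreducible representation of `∏ Gᵢ` is a tensor product
`⊗ Vᵢ` (p. 214). This file proves the identity **directly for every representation `V`**, over
any field of characteristic zero, with no appeal to irreducibility, semisimplicity, tensor
products or finite-dimensionality of `V`; the groups enter only through pairwise commuting
families of operators with finite image. This is the form needed for a formal proof of the named
fact `Literature.NumberTheory.EllipticCurves.ModularForms.atkinLehnerMainLemma1` (`NewformsMainLemma`, Diamond–Shurman Thm. 5.7.1),
where `G = SL(2, ℤ)` acts on `S_k(Γ(N))` through its finite quotient `SL(2, ℤ/Nℤ)` and `Hᵢ, Kᵢ`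
are generated by powers of `(1 0; 1 1)` and `(1 1; 0 1)` (one index per prime dividing `N`).

## Main result

Fixed spaces `V^S` are the tree's `Literature.Representation.fixedSubmodule ρ S`
(`Literature.NumberTheory.GaloisRepresentations.ArtinConductorIntegrality`, `∀ g ∈ S, ρ g v = v`),
stabilisers the tree's `Representation.stabilizerSubgroup ρ v`
(`Literature.NumberTheory.Automorphic.SmoothRepresentation`).

* `Literature.RepresentationTheory.FiniteGroups.Representation.fixedSubmodule_inf_iSup_le`: let `ρ : G →* End_F(V)` be a linear action of
  a group `G` on a vector space `V` over a field `F` of characteristic zero, `s` a finite set of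
  indices, `H i, K i ≤ G` subgroups such that for `i ≠ j` the operators `ρ x`, `x ∈ H i ⊔ K i`,
  commute with the operators `ρ y`, `y ∈ H j ⊔ K j`, and each `ρ(H i ⊔ K i)` is finite. Then
  `V^{⨆ H i} ⊓ ⨆ᵢ V^{K i} ≤ ⨆ᵢ V^{K i ⊔ ⨆ⱼ H j}`;
  `fixedSubmodule_inf_iSup_eq` is the equality (Diamond–Shurman (5.18) for arbitrary `V`),
  `fixedSubmodule_inf_iSup_eq_of_finite` the case of a finite group, and
  `exists_sum_eq_of_mem_fixedSubmodule` the element-wise form (`v` fixed by every `H i` and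
  `v = ∑ uᵢ` with `uᵢ` fixed by `K i` ⟹ `v = ∑ wᵢ` with `wᵢ` fixed by `K i` and by every `H j`).

## Proof

Induction on `s`, the space `V` being fixed (`exists_sum_eq_step` is the inductive step). At
`i₀` let `M` be the (finite) group of units `ρ(H_{i₀} ⊔ K_{i₀})` and `U = (M → V)`, with `M`
acting by right translation of the argument (`rtrans`) and the other `ρ(H j ⊔ K j)` acting
pointwise; `Φ v = (m ↦ m v)` embeds `V` equivariantly into `U` with equivariant retraction
`Ψ Y = |M|⁻¹ ∑ₘ m⁻¹ Y(m)` (`embedΦ`, `retractΨ`, `retractΨ_embedΦ`). On `R = (M → F)` let `A, B`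
be the right-`H_{i₀}`-, resp. `K_{i₀}`-invariant functions; linear algebra
(`exists_compatible_projections`) gives `p_C, p_A ∈ End R` with `p_C + p_A = id` on `A`,
`im p_C ≤ A ⊓ B`, `im p_A ≤ A`, `p_A(B) = 0`. Endomorphisms of `R` act on `U` through their
matrices (`liftEnd`, multiplicative and commuting with pointwise operators). For
`Y = Φ v = Φ u_{i₀} + ∑_{i ≠ i₀} Φ uᵢ` one gets `Y = p̂_C Y + p̂_A Y`, `p̂_A Φ u_{i₀} = 0`, the
induction hypothesis applies pointwise to `p̂_A Y`, and averaging over `H_{i₀}` (`ravg`) followed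
by `Ψ` gives the decomposition of `v`.

## References

* F. Diamond, J. Shurman, *A first course in modular forms*, GTM 228, Springer 2005, §5.7,
  Thm. 5.7.5, (5.17), Prop. 5.7.7 (PDF pp. 213–215). doi:10.1007/978-0-387-27226-9
* D. Carlton, *On a result of Atkin and Lehner*, arXiv:math/9910027 (1999); *Moduli for pairs of
  elliptic curves with isomorphic `N`-torsion*, Manuscripta Math. 105 (2001) (as cited by
  Diamond–Shurman, p. 212, [Car99], [Car01]).
-/

open Module

open scoped BigOperators

namespace Literature.RepresentationTheory.FiniteGroups.Representation

/-! ### Fixed submodules of a linear action -/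

section Fixed

variable {F V G : Type*} [Field F] [AddCommGroup V] [Module F V] [Group G]

/-- `v ∈ V^S` (the tree's `Literature.Representation.fixedSubmodule ρ S`, i.e. `∀ g ∈ S, ρ g v = v`)
iff `S` is contained in the stabiliser of `v` (the tree's `Representation.stabilizerSubgroup ρ v`,
`Literature.NumberTheory.Automorphic.SmoothRepresentation`). [folklore] -/
lemma mem_fixedSubmodule_iff_le {ρ : G →* Module.End F V} {S : Subgroup G} {v : V} :
    v ∈ Literature.NumberTheory.GaloisRepresentations.Representation.fixedSubmodule ρ S ↔ S ≤ _root_.Representation.stabilizerSubgroup ρ v :=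
  Literature.NumberTheory.GaloisRepresentations.Representation.mem_fixedSubmodule ρ S v

/-- `S ↦ V^S` is antitone. [folklore] -/
lemma fixedSubmodule_antitone (ρ : G →* Module.End F V) : Antitone (Literature.NumberTheory.GaloisRepresentations.Representation.fixedSubmodule ρ) :=
  fun S T hST v hv ↦ (Literature.NumberTheory.GaloisRepresentations.Representation.mem_fixedSubmodule ρ S v).mpr fun g hg ↦
    (Literature.NumberTheory.GaloisRepresentations.Representation.mem_fixedSubmodule ρ T v).mp hv g (hST hg)

/-- `V^{S ⊔ T} = V^S ⊓ V^T`. [folklore] -/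
lemma fixedSubmodule_sup (ρ : G →* Module.End F V) (S T : Subgroup G) :
    Literature.NumberTheory.GaloisRepresentations.Representation.fixedSubmodule ρ (S ⊔ T) = Literature.NumberTheory.GaloisRepresentations.Representation.fixedSubmodule ρ S ⊓ Literature.NumberTheory.GaloisRepresentations.Representation.fixedSubmodule ρ T := by
  ext v
  simp only [Submodule.mem_inf, mem_fixedSubmodule_iff_le, sup_le_iff]

/-- `V^{⨆ i ∈ s, S i} = ⨅ i ∈ s, V^{S i}` (membership form). [folklore] -/
lemma mem_fixedSubmodule_biSup_iff (ρ : G →* Module.End F V) {ι : Type*} (s : Finset ι)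
    (S : ι → Subgroup G) (v : V) :
    v ∈ Literature.NumberTheory.GaloisRepresentations.Representation.fixedSubmodule ρ (⨆ i ∈ s, S i) ↔ ∀ i ∈ s, v ∈ Literature.NumberTheory.GaloisRepresentations.Representation.fixedSubmodule ρ (S i) := by
  simp only [mem_fixedSubmodule_iff_le, iSup_le_iff]

/-- Operators commuting on generators commute on the generated subgroups. [folklore] -/
lemma commute_of_mem_closure (ρ : G →* Module.End F V) {S T : Set G}
    (h : ∀ x ∈ S, ∀ y ∈ T, Commute (ρ x) (ρ y)) :
    ∀ x ∈ Subgroup.closure S, ∀ y ∈ Subgroup.closure T, Commute (ρ x) (ρ y) := by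
  have key : ∀ (A : Set G) (b : Module.End F V), (∀ x ∈ A, Commute (ρ x) b) →
      ∀ x ∈ Subgroup.closure A, Commute (ρ x) b := by
    intro A b hA x hx
    induction hx using Subgroup.closure_induction with
    | mem x hx => exact hA x hx
    | one => simp
    | mul x y _ _ hx hy => rw [map_mul]; exact hx.mul_left hy
    | inv x _ hx =>
      have : ρ x⁻¹ = ((ρ.toHomUnits x)⁻¹ : (Module.End F V)ˣ) := by
        rw [← map_inv]; rfl
      rw [this]
      exact Commute.units_inv_left (u := ρ.toHomUnits x) hx
  intro x hx y hy
  refine key S (ρ y) (fun x' hx' ↦ ?_) x hx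
  exact (key T (ρ x') (fun y' hy' ↦ (h x' hx' y' hy').symm) y hy).symm

end Fixed

/-! ### Right translations on `M → W` -/

section Translation

variable (F : Type*) [Field F] {M : Type*} [Group M] (W : Type*) [AddCommMonoid W] [Module F W]

/-- Right translation of the argument, `(t_x Y)(m) = Y(m x)`, on `M → W`. [folklore] -/
abbrev rtrans (x : M) : Module.End F (M → W) :=
  LinearMap.funLeft F W (· * x)

/-- Unfolding lemma. [folklore] -/
@[simp] lemma rtrans_apply (x : M) (Y : M → W) (m : M) : rtrans F W x Y m = Y (m * x) :=
  rfl

/-- Auxiliary identity for the proof of `exists_sum_eq_step`. [folklore] -/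
lemma rtrans_mul (x y : M) : rtrans F W x * rtrans F W y = rtrans F W (x * y) := by
  refine LinearMap.ext fun Y ↦ funext fun m ↦ ?_
  simp only [Module.End.mul_apply, rtrans_apply, mul_assoc]

/-- The submodule of right-`S`-invariant functions `M → W`. [folklore] -/
def rtransInv (S : Subgroup M) : Submodule F (M → W) where
  carrier := {Y | ∀ x ∈ S, rtrans F W x Y = Y}
  zero_mem' x _ := by simp
  add_mem' {Y Y'} hY hY' x hx := by rw [map_add, hY x hx, hY' x hx]
  smul_mem' c {Y} hY x hx := by rw [map_smul, hY x hx]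

/-- Unfolding lemma. [folklore] -/
lemma mem_rtransInv_iff {S : Subgroup M} {Y : M → W} :
    Y ∈ rtransInv F W S ↔ ∀ x ∈ S, rtrans F W x Y = Y :=
  Iff.rfl

end Translation

/-! ### Endomorphisms of `M → F` acting on `M → V` through their matrices -/

section Lift

variable {F : Type*} [Field F] (V : Type*) [AddCommGroup V] [Module F V]
variable {M : Type*} [Fintype M] [DecidableEq M]

/-- The endomorphism of `M → V` with the same matrix as `p ∈ End (M → F)`:
`(p̂ Y)(m) = ∑_{m'} p(δ_{m'})(m) • Y(m')` (i.e. `p ⊗ id_V` on `(M → F) ⊗ V = (M → V)`). [folklore] -/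
def liftEnd (p : Module.End F (M → F)) : Module.End F (M → V) where
  toFun Y m := ∑ m', p (Pi.single m' 1) m • Y m'
  map_add' Y Y' := by
    funext m
    simp only [Pi.add_apply, smul_add, Finset.sum_add_distrib]
  map_smul' c Y := by
    funext m
    simp only [Pi.smul_apply, RingHom.id_apply, Finset.smul_sum, smul_smul, mul_comm c]

variable {V}

/-- Unfolding lemma. [folklore] -/
@[simp] lemma liftEnd_apply (p : Module.End F (M → F)) (Y : M → V) (m : M) :
    liftEnd V p Y m = ∑ m', p (Pi.single m' 1) m • Y m' :=
  rfl

/-- `r = ∑ₘ r(m) δₘ`. [folklore] -/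
lemma eq_sum_smul_single (r : M → F) :
    r = ∑ m, r m • (Pi.single m (1 : F) : M → F) := by
  conv_lhs => rw [← Finset.univ_sum_single r]
  refine Finset.sum_congr rfl fun m _ ↦ ?_
  rw [← Pi.single_smul', smul_eq_mul, mul_one]

/-- Matrix expansion of `p r`. [folklore] -/
lemma apply_apply_eq_sum (p : Module.End F (M → F)) (r : M → F) (m : M) :
    p r m = ∑ m', r m' * p (Pi.single m' 1) m := by
  conv_lhs => rw [eq_sum_smul_single r]
  simp only [map_sum, map_smul, Finset.sum_apply, Pi.smul_apply, smul_eq_mul]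

variable (V) in
/-- Auxiliary identity for the proof of `exists_sum_eq_step`. [folklore] -/
lemma liftEnd_one : liftEnd V (1 : Module.End F (M → F)) = 1 := by
  refine LinearMap.ext fun Y ↦ funext fun m ↦ ?_
  simp only [liftEnd_apply, Module.End.one_apply, Pi.single_apply, ite_smul, one_smul, zero_smul,
    Finset.sum_ite_eq, Finset.mem_univ, if_true]

/-- Auxiliary identity for the proof of `exists_sum_eq_step`. [folklore] -/
lemma liftEnd_mul (p p' : Module.End F (M → F)) :
    liftEnd V (p * p') = liftEnd V p * liftEnd V p' := by
  refine LinearMap.ext fun Y ↦ funext fun m ↦ ?_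
  simp only [liftEnd_apply, Module.End.mul_apply]
  have h : ∀ m', p (p' (Pi.single m' 1)) m =
      ∑ m'', p' (Pi.single m' 1) m'' * p (Pi.single m'' 1) m :=
    fun m' ↦ apply_apply_eq_sum p _ m
  simp only [h, Finset.sum_smul, Finset.smul_sum, smul_smul]
  conv_lhs => rw [Finset.sum_comm]
  exact Finset.sum_congr rfl fun _ _ ↦ Finset.sum_congr rfl fun _ _ ↦ by rw [mul_comm]

/-- Auxiliary identity for the proof of `exists_sum_eq_step`. [folklore] -/
lemma liftEnd_add (p p' : Module.End F (M → F)) :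
    liftEnd V (p + p') = liftEnd V p + liftEnd V p' := by
  refine LinearMap.ext fun Y ↦ funext fun m ↦ ?_
  simp only [liftEnd_apply, LinearMap.add_apply, Pi.add_apply, add_smul, Finset.sum_add_distrib]

/-- Auxiliary identity for the proof of `exists_sum_eq_step`. [folklore] -/
lemma liftEnd_smul (c : F) (p : Module.End F (M → F)) :
    liftEnd V (c • p) = c • liftEnd V p := by
  refine LinearMap.ext fun Y ↦ funext fun m ↦ ?_
  simp only [liftEnd_apply, LinearMap.smul_apply, Pi.smul_apply, smul_eq_mul, mul_smul,
    Finset.smul_sum]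

variable (V) in
/-- `liftEnd` as a linear map (it is even an `F`-algebra homomorphism: `liftEnd_one`,
`liftEnd_mul`). [folklore] -/
def liftEndₗ : Module.End F (M → F) →ₗ[F] Module.End F (M → V) where
  toFun := liftEnd V
  map_add' := liftEnd_add
  map_smul' := liftEnd_smul

/-- Unfolding lemma. [folklore] -/
@[simp] lemma liftEndₗ_apply (p : Module.End F (M → F)) : liftEndₗ V p = liftEnd V p := rfl

/-- Auxiliary identity for the proof of `exists_sum_eq_step`. [folklore] -/
lemma liftEnd_sum {α : Type*} (t : Finset α) (p : α → Module.End F (M → F)) :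
    liftEnd V (∑ a ∈ t, p a) = ∑ a ∈ t, liftEnd V (p a) := by
  rw [← liftEndₗ_apply, map_sum]
  rfl

/-- Auxiliary identity for the proof of `exists_sum_eq_step`. [folklore] -/
lemma liftEnd_zero : liftEnd V (0 : Module.End F (M → F)) = 0 := by
  rw [← liftEndₗ_apply, map_zero]

/-- Lifted endomorphisms commute with pointwise ones. [folklore] -/
lemma liftEnd_compLeft (p : Module.End F (M → F)) (T : Module.End F V) (Y : M → V) :
    liftEnd V p (T.compLeft M Y) = T.compLeft M (liftEnd V p Y) := by
  funext m
  simp only [liftEnd_apply, LinearMap.compLeft_apply, Function.comp_apply, map_sum, map_smul]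

variable [Group M]

/-- The lift of a translation is the translation. [folklore] -/
lemma liftEnd_rtrans (x : M) : liftEnd V (rtrans F F x) = rtrans F V x := by
  refine LinearMap.ext fun Y ↦ funext fun m ↦ ?_
  simp only [liftEnd_apply, rtrans_apply, Pi.single_apply, ite_smul, one_smul, zero_smul,
    Finset.sum_ite_eq, Finset.mem_univ, if_true]

/-- If `im p` consists of right-`S`-invariant functions then so does `im p̂`. [folklore] -/
lemma liftEnd_apply_mem_rtransInv (S : Subgroup M) (p : Module.End F (M → F))
    (hp : ∀ r, p r ∈ rtransInv F F S) (Y : M → V) : liftEnd V p Y ∈ rtransInv F V S := by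
  intro x hx
  funext m
  simp only [rtrans_apply, liftEnd_apply]
  refine Finset.sum_congr rfl fun m' _ ↦ ?_
  have h := congrFun (hp (Pi.single m' 1) x hx) m
  rw [rtrans_apply] at h
  rw [h]

variable (F) in
open scoped Classical in
/-- The averaging operator `e_S = |S|⁻¹ ∑_{x ∈ S} t_x` on `M → F`. [folklore] -/
noncomputable def ravg (S : Subgroup M) : Module.End F (M → F) :=
  (Fintype.card S : F)⁻¹ • ∑ x : S, rtrans F F (x : M)

open scoped Classical in
/-- Auxiliary identity for the proof of `exists_sum_eq_step`. [folklore] -/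
lemma liftEnd_ravg (S : Subgroup M) :
    liftEnd V (ravg F S) = (Fintype.card S : F)⁻¹ • ∑ x : S, rtrans F V (x : M) := by
  rw [ravg, liftEnd_smul, liftEnd_sum]
  simp_rw [liftEnd_rtrans]

open scoped Classical in
/-- `ê_S Y = Y` for right-`S`-invariant `Y`. [folklore] -/
lemma liftEnd_ravg_apply_of_mem [CharZero F] (S : Subgroup M) {Y : M → V}
    (hY : Y ∈ rtransInv F V S) : liftEnd V (ravg F S) Y = Y := by
  rw [liftEnd_ravg, LinearMap.smul_apply, LinearMap.sum_apply]
  have : ∑ x : S, rtrans F V (x : M) Y = ∑ _x : S, Y :=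
    Finset.sum_congr rfl fun x _ ↦ hY x x.2
  have hc : (Fintype.card S : F) ≠ 0 := Nat.cast_ne_zero.mpr Fintype.card_ne_zero
  rw [this, Finset.sum_const, Finset.card_univ, ← Nat.cast_smul_eq_nsmul F, smul_smul,
    inv_mul_cancel₀ hc, one_smul]

omit [DecidableEq M] in
open scoped Classical in
/-- `e_S r` is right-`S`-invariant. [folklore] -/
lemma ravg_apply_mem (S : Subgroup M) (r : M → F) : ravg F S r ∈ rtransInv F F S := by
  intro x hx
  rw [ravg, LinearMap.smul_apply, map_smul, LinearMap.sum_apply, map_sum]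
  congr 1
  simp_rw [← Module.End.mul_apply, rtrans_mul]
  exact Fintype.sum_equiv (Equiv.mulLeft ⟨x, hx⟩) _ _ fun y ↦ rfl

/-- If `p` kills the right-`S`-invariant functions then `p̂` kills the right-`S`-invariant
`V`-valued functions. [folklore] -/
lemma liftEnd_apply_eq_zero_of_mem [CharZero F] (S : Subgroup M) (p : Module.End F (M → F))
    (hp : ∀ r ∈ rtransInv F F S, p r = 0) {Y : M → V} (hY : Y ∈ rtransInv F V S) :
    liftEnd V p Y = 0 := by
  rw [← liftEnd_ravg_apply_of_mem S hY, ← Module.End.mul_apply, ← liftEnd_mul]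
  have : p * ravg F S = 0 := LinearMap.ext fun r ↦ hp _ (ravg_apply_mem S r)
  rw [this, liftEnd_zero, LinearMap.zero_apply]

/-- If `p` is the identity on the right-`S`-invariant functions then `p̂` is the identity on the
right-`S`-invariant `V`-valued functions. [folklore] -/
lemma liftEnd_apply_eq_self_of_mem [CharZero F] (S : Subgroup M) (p : Module.End F (M → F))
    (hp : ∀ r ∈ rtransInv F F S, p r = r) {Y : M → V} (hY : Y ∈ rtransInv F V S) :
    liftEnd V p Y = Y := by
  have : p * ravg F S = ravg F S := LinearMap.ext fun r ↦ hp _ (ravg_apply_mem S r)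
  calc liftEnd V p Y = liftEnd V p (liftEnd V (ravg F S) Y) := by
        rw [liftEnd_ravg_apply_of_mem S hY]
    _ = liftEnd V (p * ravg F S) Y := by rw [liftEnd_mul]; rfl
    _ = liftEnd V (ravg F S) Y := by rw [this]
    _ = Y := liftEnd_ravg_apply_of_mem S hY

end Lift

/-! ### Compatible projections for a pair of subspaces -/

section Projections

variable {F R : Type*} [Field F] [AddCommGroup R] [Module F R]

/-- For subspaces `A, B` of a vector space `R` there are `p_C, p_A ∈ End R` with
`p_C + p_A = id` on `A`, `im p_C ≤ A ⊓ B`, `im p_A ≤ A` and `p_A(B) = 0` (choose complements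
`A = (A ⊓ B) ⊕ A'`, `B = (A ⊓ B) ⊕ B'`, `R = A ⊕ E` with `B' ≤ E`). [folklore] -/
lemma exists_compatible_projections (A B : Submodule F R) :
    ∃ pC pA : Module.End F R, (∀ a ∈ A, pC a + pA a = a) ∧ (∀ r, pC r ∈ A ⊓ B) ∧
      (∀ r, pA r ∈ A) ∧ (∀ b ∈ B, pA b = 0) := by
  -- `B = (A ⊓ B) ⊕ B'`
  obtain ⟨B₀, hB₀⟩ := Submodule.exists_isCompl ((A ⊓ B).comap B.subtype)
  have hCB' : ∀ x ∈ A ⊓ B, x ∈ B₀.map B.subtype → x = 0 := by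
    intro x hxC hxB'
    obtain ⟨y, hy, rfl⟩ := Submodule.mem_map.mp hxB'
    have hy' : y ∈ (A ⊓ B).comap B.subtype := hxC
    have : y ∈ (A ⊓ B).comap B.subtype ⊓ B₀ := ⟨hy', hy⟩
    rw [hB₀.inf_eq_bot, Submodule.mem_bot] at this
    simp [this]
  have hCB'sup : ∀ b ∈ B, ∃ c ∈ A ⊓ B, ∃ b' ∈ B₀.map B.subtype, c + b' = b := by
    intro b hb
    have htop : (⟨b, hb⟩ : B) ∈ (A ⊓ B).comap B.subtype ⊔ B₀ := by
      rw [hB₀.sup_eq_top]; trivial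
    obtain ⟨y, hy, z, hz, hyz⟩ := Submodule.mem_sup.mp htop
    refine ⟨(y : R), hy, (z : R), Submodule.mem_map_of_mem hz, ?_⟩
    simpa using congrArg Subtype.val hyz
  -- `A ⊓ B' = ⊥`
  have hAB' : ∀ x ∈ A, x ∈ B₀.map B.subtype → x = 0 := fun x hxA hxB' ↦
    hCB' x ⟨hxA, Submodule.map_subtype_le B B₀ hxB'⟩ hxB'
  -- `R = (A ⊔ B') ⊕ D`; `E := B' ⊔ D` is a complement of `A` containing `B'`
  obtain ⟨D, hD⟩ := Submodule.exists_isCompl (A ⊔ B₀.map B.subtype)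
  have hAE : IsCompl A (B₀.map B.subtype ⊔ D) := by
    constructor
    · rw [Submodule.disjoint_def]
      intro x hxA hxE
      obtain ⟨b', hb', d, hd, rfl⟩ := Submodule.mem_sup.mp hxE
      have hd' : d ∈ A ⊔ B₀.map B.subtype := by
        have : b' + d - b' ∈ A ⊔ B₀.map B.subtype :=
          Submodule.sub_mem _ (Submodule.mem_sup_left hxA) (Submodule.mem_sup_right hb')
        simpa using this
      have hd0 : d = 0 := (Submodule.disjoint_def.mp hD.disjoint) d hd' hd
      subst hd0
      rw [add_zero] at hxA ⊢
      exact hAB' b' hxA hb'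
    · rw [codisjoint_iff, eq_top_iff]
      intro x _
      have hx : x ∈ (A ⊔ B₀.map B.subtype) ⊔ D := by rw [hD.sup_eq_top]; trivial
      rwa [sup_assoc] at hx
  -- `A = (A ⊓ B) ⊕ A'` inside `A`
  obtain ⟨A₀, hA₀⟩ := Submodule.exists_isCompl ((A ⊓ B).comap A.subtype)
  refine ⟨A.subtype ∘ₗ ((A ⊓ B).comap A.subtype).projection A₀ hA₀ ∘ₗ A.projectionOnto _ hAE,
    A.projection _ hAE -
      A.subtype ∘ₗ ((A ⊓ B).comap A.subtype).projection A₀ hA₀ ∘ₗ A.projectionOnto _ hAE,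
    fun a ha ↦ ?_, fun r ↦ ?_, fun r ↦ ?_, fun b hb ↦ ?_⟩
  · rw [LinearMap.sub_apply, add_sub_cancel]
    exact Submodule.projection_apply_of_mem_left hAE ha
  · exact Submodule.projection_apply_mem hA₀ (A.projectionOnto _ hAE r)
  · refine Submodule.sub_mem _ (Submodule.projection_apply_mem hAE r) ?_
    exact (((A ⊓ B).comap A.subtype).projection A₀ hA₀ (A.projectionOnto _ hAE r)).2
  · obtain ⟨c, hc, b', hb', rfl⟩ := hCB'sup b hb
    have hcA : c ∈ A := (Submodule.mem_inf.mp hc).1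
    have hb'E : b' ∈ B₀.map B.subtype ⊔ D := Submodule.mem_sup_left hb'
    have h1 : A.projectionOnto _ hAE (c + b') = ⟨c, hcA⟩ := by
      rw [map_add, Submodule.projectionOnto_apply_of_mem_left hAE hcA,
        Submodule.projectionOnto_apply_of_mem_right hAE hb'E, add_zero]
    have h2 : ((A ⊓ B).comap A.subtype).projection A₀ hA₀ ⟨c, hcA⟩ = ⟨c, hcA⟩ :=
      Submodule.projection_apply_of_mem_left hA₀ hc
    have h3 : A.projection _ hAE (c + b') = c := by
      rw [map_add, Submodule.projection_apply_of_mem_left hAE hcA,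
        Submodule.projection_apply_of_mem_right hAE hb'E, add_zero]
    rw [LinearMap.sub_apply, h3, LinearMap.comp_apply, LinearMap.comp_apply, h1, h2]
    simp

end Projections

/-! ### The equivariant retract `V → (M → V) → V` for a finite group of units `M ≤ End(V)ˣ` -/

section Retract

variable {F V : Type*} [Field F] [AddCommGroup V] [Module F V]
variable (Mgrp : Subgroup (Module.End F V)ˣ)

/-- The operator on `V` underlying `m ∈ M ≤ End(V)ˣ`. [folklore] -/
abbrev unitOp (m : Mgrp) : Module.End F V := ((m : (Module.End F V)ˣ) : Module.End F V)

/-- Auxiliary identity for the proof of `exists_sum_eq_step`. [folklore] -/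
lemma unitOp_mul (m m' : Mgrp) : unitOp Mgrp (m * m') = unitOp Mgrp m * unitOp Mgrp m' := rfl

/-- Auxiliary identity for the proof of `exists_sum_eq_step`. [folklore] -/
lemma unitOp_inv_mul_self (m : Mgrp) : unitOp Mgrp m⁻¹ * unitOp Mgrp m = 1 := by
  rw [← unitOp_mul, inv_mul_cancel]; rfl

/-- `Φ v = (m ↦ m v) : V → (M → V)`. [folklore] -/
def embedΦ : V →ₗ[F] (Mgrp → V) :=
  LinearMap.pi fun m ↦ unitOp Mgrp m

/-- Unfolding lemma. [folklore] -/
@[simp] lemma embedΦ_apply (v : V) (m : Mgrp) : embedΦ Mgrp v m = unitOp Mgrp m v := rfl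

/-- `Φ (x v) = t_x (Φ v)` for `x ∈ M`. [folklore] -/
lemma embedΦ_unitOp (x : Mgrp) (v : V) :
    embedΦ Mgrp (unitOp Mgrp x v) = rtrans F V x (embedΦ Mgrp v) := by
  funext m
  rw [rtrans_apply, embedΦ_apply, embedΦ_apply, unitOp_mul, Module.End.mul_apply]

/-- `Φ (T v) = T ∘ Φ v` for `T` commuting with `M`. [folklore] -/
lemma embedΦ_commute (T : Module.End F V) (hT : ∀ m : Mgrp, Commute T (unitOp Mgrp m)) (v : V) :
    embedΦ Mgrp (T v) = T.compLeft Mgrp (embedΦ Mgrp v) := by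
  funext m
  rw [LinearMap.compLeft_apply, Function.comp_apply, embedΦ_apply, embedΦ_apply,
    ← Module.End.mul_apply, ← (hT m).eq, Module.End.mul_apply]

variable [Fintype Mgrp]

/-- `Ψ Y = |M|⁻¹ ∑ₘ m⁻¹ Y(m) : (M → V) → V`. [folklore] -/
noncomputable def retractΨ : (Mgrp → V) →ₗ[F] V :=
  (Fintype.card Mgrp : F)⁻¹ • ∑ m : Mgrp, unitOp Mgrp m⁻¹ ∘ₗ LinearMap.proj m

/-- Unfolding lemma. [folklore] -/
lemma retractΨ_apply (Y : Mgrp → V) :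
    retractΨ Mgrp Y = (Fintype.card Mgrp : F)⁻¹ • ∑ m : Mgrp, unitOp Mgrp m⁻¹ (Y m) := by
  simp [retractΨ, LinearMap.sum_apply]

/-- `Ψ (Φ v) = v`. [folklore] -/
lemma retractΨ_embedΦ [CharZero F] (v : V) : retractΨ Mgrp (embedΦ Mgrp v) = v := by
  rw [retractΨ_apply]
  have h : ∀ m : Mgrp, unitOp Mgrp m⁻¹ (embedΦ Mgrp v m) = v := fun m ↦ by
    rw [embedΦ_apply, ← Module.End.mul_apply, unitOp_inv_mul_self, Module.End.one_apply]
  have hc : (Fintype.card Mgrp : F) ≠ 0 := Nat.cast_ne_zero.mpr Fintype.card_ne_zero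
  simp_rw [h, Finset.sum_const, Finset.card_univ, ← Nat.cast_smul_eq_nsmul F, smul_smul,
    inv_mul_cancel₀ hc, one_smul]

/-- `Ψ (t_x Y) = x (Ψ Y)` for `x ∈ M`. [folklore] -/
lemma retractΨ_rtrans (x : Mgrp) (Y : Mgrp → V) :
    retractΨ Mgrp (rtrans F V x Y) = unitOp Mgrp x (retractΨ Mgrp Y) := by
  rw [retractΨ_apply, retractΨ_apply, map_smul, map_sum]
  congr 1
  have h : ∀ m : Mgrp, unitOp Mgrp m⁻¹ (rtrans F V x Y m) =
      unitOp Mgrp x (unitOp Mgrp (m * x)⁻¹ (Y (m * x))) := fun m ↦ by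
    rw [rtrans_apply, ← Module.End.mul_apply, ← unitOp_mul, mul_inv_rev, ← mul_assoc,
      mul_inv_cancel, one_mul]
  simp_rw [h]
  exact Fintype.sum_equiv (Equiv.mulRight x) _ _ fun m ↦ rfl

/-- `Ψ (T ∘ Y) = T (Ψ Y)` for `T` commuting with `M`. [folklore] -/
lemma retractΨ_compLeft (T : Module.End F V) (hT : ∀ m : Mgrp, Commute T (unitOp Mgrp m))
    (Y : Mgrp → V) : retractΨ Mgrp (T.compLeft Mgrp Y) = T (retractΨ Mgrp Y) := by
  rw [retractΨ_apply, retractΨ_apply, map_smul, map_sum]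
  congr 1
  refine Finset.sum_congr rfl fun m _ ↦ ?_
  show unitOp Mgrp m⁻¹ (T (Y m)) = T (unitOp Mgrp m⁻¹ (Y m))
  rw [← Module.End.mul_apply, ← (hT m⁻¹).eq, Module.End.mul_apply]

end Retract

/-! ### The inductive step and the main theorem -/

section Core

variable {F V G : Type*} [Field F] [CharZero F] [AddCommGroup V] [Module F V] [Group G]

/-- **Inductive step** of `exists_sum_eq_of_mem_fixedSubmodule` (see the module docstring):
the statement for the index set `insert i₀ s'` from the statement for `s'` (hypothesis `IH`,
for the same space `V`). [cite: DiamondShurman2005, Prop. 5.7.7] -/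
theorem exists_sum_eq_step (ρ : G →* Module.End F V) {ι : Type*} (H K : ι → Subgroup G)
    (hfin : ∀ i, (ρ '' ((H i ⊔ K i : Subgroup G) : Set G)).Finite)
    (hcomm : ∀ i j, i ≠ j → ∀ x ∈ H i ⊔ K i, ∀ y ∈ H j ⊔ K j, Commute (ρ x) (ρ y))
    (i₀ : ι) (s' : Finset ι) (hi₀ : i₀ ∉ s')
    (IH : ∀ (v : V) (u : ι → V), (∀ i ∈ s', v ∈ Literature.NumberTheory.GaloisRepresentations.Representation.fixedSubmodule ρ (H i)) →
      (∀ i ∈ s', u i ∈ Literature.NumberTheory.GaloisRepresentations.Representation.fixedSubmodule ρ (K i)) → ∑ i ∈ s', u i = v →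
      ∃ w : ι → V, ∑ i ∈ s', w i = v ∧
        ∀ i ∈ s', w i ∈ Literature.NumberTheory.GaloisRepresentations.Representation.fixedSubmodule ρ (K i) ∧ ∀ j ∈ s', w i ∈ Literature.NumberTheory.GaloisRepresentations.Representation.fixedSubmodule ρ (H j))
    (v : V) (u : ι → V) (hv₀ : v ∈ Literature.NumberTheory.GaloisRepresentations.Representation.fixedSubmodule ρ (H i₀))
    (hv : ∀ i ∈ s', v ∈ Literature.NumberTheory.GaloisRepresentations.Representation.fixedSubmodule ρ (H i)) (hu₀ : u i₀ ∈ Literature.NumberTheory.GaloisRepresentations.Representation.fixedSubmodule ρ (K i₀))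
    (hu : ∀ i ∈ s', u i ∈ Literature.NumberTheory.GaloisRepresentations.Representation.fixedSubmodule ρ (K i)) (hsum : u i₀ + ∑ i ∈ s', u i = v) :
    ∃ (w₀ : V) (w : ι → V), w₀ + ∑ i ∈ s', w i = v ∧
      (w₀ ∈ Literature.NumberTheory.GaloisRepresentations.Representation.fixedSubmodule ρ (K i₀) ∧ w₀ ∈ Literature.NumberTheory.GaloisRepresentations.Representation.fixedSubmodule ρ (H i₀) ∧
        ∀ j ∈ s', w₀ ∈ Literature.NumberTheory.GaloisRepresentations.Representation.fixedSubmodule ρ (H j)) ∧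
      ∀ i ∈ s', w i ∈ Literature.NumberTheory.GaloisRepresentations.Representation.fixedSubmodule ρ (K i) ∧ w i ∈ Literature.NumberTheory.GaloisRepresentations.Representation.fixedSubmodule ρ (H i₀) ∧
        ∀ j ∈ s', w i ∈ Literature.NumberTheory.GaloisRepresentations.Representation.fixedSubmodule ρ (H j) := by
  classical
  simp only [Literature.NumberTheory.GaloisRepresentations.Representation.mem_fixedSubmodule] at hv₀ hv hu₀ hu IH ⊢
  -- the finite group `M = ρ(H i₀ ⊔ K i₀)` of units
  obtain ⟨Mgrp, hMgrp⟩ :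
      ∃ S : Subgroup (Module.End F V)ˣ, S = (H i₀ ⊔ K i₀).map ρ.toHomUnits := ⟨_, rfl⟩
  have hMfin : Finite Mgrp := by
    have h1 : ((Mgrp : Set (Module.End F V)ˣ)).Finite := by
      rw [hMgrp, Subgroup.coe_map]
      refine Set.Finite.of_finite_image ?_ (fun a _ b _ h ↦ Units.ext h)
      have : (fun x ↦ ((ρ.toHomUnits x : (Module.End F V)ˣ) : Module.End F V)) = ⇑ρ :=
        funext fun x ↦ rfl
      rw [Set.image_image, this]
      exact hfin i₀
    exact h1.to_subtype
  letI : Fintype Mgrp := Fintype.ofFinite Mgrp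
  have hmemM : ∀ x ∈ H i₀ ⊔ K i₀, ρ.toHomUnits x ∈ Mgrp := fun x hx ↦ by
    rw [hMgrp]; exact Subgroup.mem_map_of_mem _ hx
  have hcommM : ∀ j ∈ s', ∀ y ∈ H j ⊔ K j, ∀ m : Mgrp, Commute (ρ y) (unitOp Mgrp m) := by
    intro j hj y hy m
    have hm : (m : (Module.End F V)ˣ) ∈ (H i₀ ⊔ K i₀).map ρ.toHomUnits := hMgrp.le m.2
    obtain ⟨x, hx, hxm⟩ := Subgroup.mem_map.mp hm
    have hne : i₀ ≠ j := fun h ↦ hi₀ (h ▸ hj)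
    have : unitOp Mgrp m = ρ x := by
      show ((m : (Module.End F V)ˣ) : Module.End F V) = ρ x
      rw [← hxm]; rfl
    rw [this]
    exact (hcomm i₀ j hne x hx y hy).symm
  -- the subgroups `H_M, K_M ≤ M`
  obtain ⟨HM, hHM⟩ : ∃ S : Subgroup Mgrp, S = ((H i₀).map ρ.toHomUnits).subgroupOf Mgrp :=
    ⟨_, rfl⟩
  obtain ⟨KM, hKM⟩ : ∃ S : Subgroup Mgrp, S = ((K i₀).map ρ.toHomUnits).subgroupOf Mgrp :=
    ⟨_, rfl⟩
  have hHM_mem : ∀ m : Mgrp, m ∈ HM → ∃ x ∈ H i₀, unitOp Mgrp m = ρ x := by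
    intro m hm
    rw [hHM, Subgroup.mem_subgroupOf] at hm
    obtain ⟨x, hx, hxm⟩ := Subgroup.mem_map.mp hm
    refine ⟨x, hx, ?_⟩
    show ((m : (Module.End F V)ˣ) : Module.End F V) = ρ x
    rw [← hxm]; rfl
  have hKM_mem : ∀ m : Mgrp, m ∈ KM → ∃ x ∈ K i₀, unitOp Mgrp m = ρ x := by
    intro m hm
    rw [hKM, Subgroup.mem_subgroupOf] at hm
    obtain ⟨x, hx, hxm⟩ := Subgroup.mem_map.mp hm
    refine ⟨x, hx, ?_⟩
    show ((m : (Module.End F V)ˣ) : Module.End F V) = ρ x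
    rw [← hxm]; rfl
  have hmemHM : ∀ y (hy : y ∈ H i₀),
      (⟨ρ.toHomUnits y, hmemM y (Subgroup.mem_sup_left hy)⟩ : Mgrp) ∈ HM := fun y hy ↦ by
    rw [hHM, Subgroup.mem_subgroupOf]; exact Subgroup.mem_map_of_mem _ hy
  have hmemKM : ∀ y (hy : y ∈ K i₀),
      (⟨ρ.toHomUnits y, hmemM y (Subgroup.mem_sup_right hy)⟩ : Mgrp) ∈ KM := fun y hy ↦ by
    rw [hKM, Subgroup.mem_subgroupOf]; exact Subgroup.mem_map_of_mem _ hy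
  -- compatible projections for the invariant functions on `M`
  obtain ⟨pC, pA, hπA, hpC, hpA, hpAB⟩ :=
    exists_compatible_projections (F := F) (rtransInv F F HM) (rtransInv F F KM)
  -- the embedding `Y = Φ v = Φ u_{i₀} + ∑ Φ u_i`
  obtain ⟨Y, hY⟩ : ∃ Y : Mgrp → V, Y = embedΦ Mgrp v := ⟨_, rfl⟩
  obtain ⟨Yu, hYu⟩ : ∃ Yu : ι → Mgrp → V, Yu = fun i ↦ embedΦ Mgrp (u i) := ⟨_, rfl⟩
  have hYsum : Y = Yu i₀ + ∑ i ∈ s', Yu i := by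
    rw [hY, hYu, ← hsum, map_add, map_sum]
  have hY_H : Y ∈ rtransInv F V HM := by
    intro m hm
    obtain ⟨x, hx, hxm⟩ := hHM_mem m hm
    rw [hY, ← embedΦ_unitOp, hxm, hv₀ x hx]
  have hYu₀_K : Yu i₀ ∈ rtransInv F V KM := by
    intro m hm
    obtain ⟨x, hx, hxm⟩ := hKM_mem m hm
    rw [hYu, ← embedΦ_unitOp, hxm, hu₀ x hx]
  have hY_pt : ∀ j ∈ s', ∀ y ∈ H j, (ρ y).compLeft Mgrp Y = Y := by
    intro j hj y hy
    rw [hY, ← embedΦ_commute Mgrp (ρ y) (hcommM j hj y (Subgroup.mem_sup_left hy)),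
      hv j hj y hy]
  have hYu_pt : ∀ i ∈ s', ∀ y ∈ K i, (ρ y).compLeft Mgrp (Yu i) = Yu i := by
    intro i hi y hy
    rw [hYu, ← embedΦ_commute Mgrp (ρ y) (hcommM i hi y (Subgroup.mem_sup_right hy)),
      hu i hi y hy]
  -- `Y = Z₀ + X` with `Z₀ = p̂_C Y`, `X = p̂_A Y = ∑_{i ∈ s'} p̂_A (Φ u_i)`
  obtain ⟨Z₀, hZ₀⟩ : ∃ Z₀ : Mgrp → V, Z₀ = liftEnd V pC Y := ⟨_, rfl⟩
  obtain ⟨X, hX⟩ : ∃ X : Mgrp → V, X = liftEnd V pA Y := ⟨_, rfl⟩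
  have hYdec : Y = Z₀ + X := by
    have h := liftEnd_apply_eq_self_of_mem (V := V) HM (pC + pA)
      (fun r hr ↦ by simpa using hπA r hr) hY_H
    rw [liftEnd_add, LinearMap.add_apply] at h
    rw [hZ₀, hX]
    exact h.symm
  have hXsum : X = ∑ i ∈ s', liftEnd V pA (Yu i) := by
    have h0 : liftEnd V pA (Yu i₀) = 0 := liftEnd_apply_eq_zero_of_mem KM pA hpAB hYu₀_K
    rw [hX, hYsum, map_add, map_sum, h0, zero_add]
  have hpC_H : ∀ r, pC r ∈ rtransInv F F HM := fun r ↦ (Submodule.mem_inf.mp (hpC r)).1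
  have hpC_K : ∀ r, pC r ∈ rtransInv F F KM := fun r ↦ (Submodule.mem_inf.mp (hpC r)).2
  have hZ₀_H : Z₀ ∈ rtransInv F V HM := hZ₀ ▸ liftEnd_apply_mem_rtransInv HM pC hpC_H Y
  have hZ₀_K : Z₀ ∈ rtransInv F V KM := hZ₀ ▸ liftEnd_apply_mem_rtransInv KM pC hpC_K Y
  have hZ₀_pt : ∀ j ∈ s', ∀ y ∈ H j, (ρ y).compLeft Mgrp Z₀ = Z₀ := by
    intro j hj y hy
    rw [hZ₀, ← liftEnd_compLeft, hY_pt j hj y hy]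
  have hX_H : X ∈ rtransInv F V HM := hX ▸ liftEnd_apply_mem_rtransInv HM pA hpA Y
  have hX_pt : ∀ j ∈ s', ∀ y ∈ H j, (ρ y).compLeft Mgrp X = X := by
    intro j hj y hy
    rw [hX, ← liftEnd_compLeft, hY_pt j hj y hy]
  have hXu_pt : ∀ i ∈ s', ∀ y ∈ K i,
      (ρ y).compLeft Mgrp (liftEnd V pA (Yu i)) = liftEnd V pA (Yu i) := by
    intro i hi y hy
    rw [← liftEnd_compLeft, hYu_pt i hi y hy]
  -- the induction hypothesis, pointwise on `X`
  have hIH : ∀ m : Mgrp, ∃ w : ι → V, ∑ i ∈ s', w i = X m ∧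
      ∀ i ∈ s', (∀ g ∈ K i, ρ g (w i) = w i) ∧ ∀ j ∈ s', ∀ g ∈ H j, ρ g (w i) = w i := by
    intro m
    refine IH (X m) (fun i ↦ liftEnd V pA (Yu i) m) ?_ ?_ ?_
    · intro j hj y hy
      have := congrFun (hX_pt j hj y hy) m
      rwa [LinearMap.compLeft_apply, Function.comp_apply] at this
    · intro i hi y hy
      have := congrFun (hXu_pt i hi y hy) m
      rwa [LinearMap.compLeft_apply, Function.comp_apply] at this
    · rw [hXsum, Finset.sum_apply]
  choose W hWsum hW using hIH
  -- average the pointwise decomposition over `H_M`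
  obtain ⟨Z, hZ⟩ : ∃ Z : ι → Mgrp → V, Z = fun i ↦ liftEnd V (ravg F HM) (fun m ↦ W m i) :=
    ⟨_, rfl⟩
  have hZ_H : ∀ i, Z i ∈ rtransInv F V HM := fun i ↦
    hZ ▸ liftEnd_apply_mem_rtransInv HM (ravg F HM) (ravg_apply_mem HM) _
  have hZ_ptK : ∀ i ∈ s', ∀ y ∈ K i, (ρ y).compLeft Mgrp (Z i) = Z i := by
    intro i hi y hy
    rw [hZ]
    dsimp only
    rw [← liftEnd_compLeft]
    congr 1
    funext m
    rw [LinearMap.compLeft_apply, Function.comp_apply]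
    exact (hW m i hi).1 y hy
  have hZ_ptH : ∀ i ∈ s', ∀ j ∈ s', ∀ y ∈ H j, (ρ y).compLeft Mgrp (Z i) = Z i := by
    intro i hi j hj y hy
    rw [hZ]
    dsimp only
    rw [← liftEnd_compLeft]
    congr 1
    funext m
    rw [LinearMap.compLeft_apply, Function.comp_apply]
    exact (hW m i hi).2 j hj y hy
  have hZsum : ∑ i ∈ s', Z i = X := by
    have h1 : (∑ i ∈ s', fun m ↦ W m i) = X := by
      funext m
      rw [Finset.sum_apply]
      exact hWsum m
    rw [hZ]
    dsimp only
    rw [← map_sum, h1]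
    exact liftEnd_ravg_apply_of_mem HM hX_H
  -- pull back along `Ψ`
  refine ⟨retractΨ Mgrp Z₀, fun i ↦ retractΨ Mgrp (Z i), ?_, ⟨?_, ?_, ?_⟩,
    fun i hi ↦ ⟨?_, ?_, ?_⟩⟩
  · rw [← map_sum, ← map_add, hZsum, ← hYdec, hY, retractΨ_embedΦ]
  · intro y hy
    have h := retractΨ_rtrans Mgrp ⟨ρ.toHomUnits y, hmemM y (Subgroup.mem_sup_right hy)⟩ Z₀
    rw [hZ₀_K _ (hmemKM y hy)] at h
    exact h.symm
  · intro y hy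
    have h := retractΨ_rtrans Mgrp ⟨ρ.toHomUnits y, hmemM y (Subgroup.mem_sup_left hy)⟩ Z₀
    rw [hZ₀_H _ (hmemHM y hy)] at h
    exact h.symm
  · intro j hj y hy
    have h := retractΨ_compLeft Mgrp (ρ y) (hcommM j hj y (Subgroup.mem_sup_left hy)) Z₀
    rw [hZ₀_pt j hj y hy] at h
    exact h.symm
  · intro y hy
    have h := retractΨ_compLeft Mgrp (ρ y) (hcommM i hi y (Subgroup.mem_sup_right hy)) (Z i)
    rw [hZ_ptK i hi y hy] at h
    exact h.symm
  · intro y hy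
    have h := retractΨ_rtrans Mgrp ⟨ρ.toHomUnits y, hmemM y (Subgroup.mem_sup_left hy)⟩ (Z i)
    rw [hZ_H i _ (hmemHM y hy)] at h
    exact h.symm
  · intro j hj y hy
    have h := retractΨ_compLeft Mgrp (ρ y) (hcommM j hj y (Subgroup.mem_sup_left hy)) (Z i)
    rw [hZ_ptH i hi j hj y hy] at h
    exact h.symm

/-- **Carlton's lemma for an arbitrary representation, element-wise form.** Let
`ρ : G →* End V` be a linear action on a vector space over a field of characteristic zero,
`H i, K i ≤ G` (`i ∈ s`) subgroups such that `ρ(H i ⊔ K i)` is finite for every `i` and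
`ρ x`, `ρ y` commute for `x ∈ H i ⊔ K i`, `y ∈ H j ⊔ K j`, `i ≠ j`. If `v` is fixed by every
`H i` and `v = ∑_{i ∈ s} u i` with `u i` fixed by `K i`, then `v = ∑_{i ∈ s} w i` with `w i`
fixed by `K i` and by every `H j` (Diamond–Shurman Prop. 5.7.7, there for irreducible
representations of `∏ G_i`; here for all `V`). [cite: DiamondShurman2005, Prop. 5.7.7] -/
theorem exists_sum_eq_of_mem_fixedSubmodule (ρ : G →* Module.End F V) {ι : Type*}
    (H K : ι → Subgroup G) (hfin : ∀ i, (ρ '' ((H i ⊔ K i : Subgroup G) : Set G)).Finite)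
    (hcomm : Pairwise fun i j ↦ ∀ x ∈ H i ⊔ K i, ∀ y ∈ H j ⊔ K j, Commute (ρ x) (ρ y))
    (s : Finset ι) (v : V) (u : ι → V) (hv : ∀ i ∈ s, v ∈ Literature.NumberTheory.GaloisRepresentations.Representation.fixedSubmodule ρ (H i))
    (hu : ∀ i ∈ s, u i ∈ Literature.NumberTheory.GaloisRepresentations.Representation.fixedSubmodule ρ (K i)) (hsum : ∑ i ∈ s, u i = v) :
    ∃ w : ι → V, ∑ i ∈ s, w i = v ∧
      ∀ i ∈ s, w i ∈ Literature.NumberTheory.GaloisRepresentations.Representation.fixedSubmodule ρ (K i) ∧ ∀ j ∈ s, w i ∈ Literature.NumberTheory.GaloisRepresentations.Representation.fixedSubmodule ρ (H j) := by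
  classical
  induction s using Finset.induction_on generalizing v u with
  | empty => exact ⟨u, hsum, fun i hi ↦ by simp at hi⟩
  | insert i₀ s' hi₀ IH =>
    rw [Finset.sum_insert hi₀] at hsum
    obtain ⟨w₀, w, hwsum, ⟨hw₀K, hw₀H₀, hw₀H⟩, hw⟩ :=
      exists_sum_eq_step ρ H K hfin (fun i j hij ↦ hcomm hij) i₀ s' hi₀
        (fun v u hv hu hsum ↦ IH v u hv hu hsum) v u (hv i₀ (Finset.mem_insert_self _ _))
        (fun i hi ↦ hv i (Finset.mem_insert_of_mem hi)) (hu i₀ (Finset.mem_insert_self _ _))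
        (fun i hi ↦ hu i (Finset.mem_insert_of_mem hi)) hsum
    refine ⟨Function.update w i₀ w₀, ?_, ?_⟩
    · rw [Finset.sum_insert hi₀, Function.update_self,
        Finset.sum_congr rfl fun i hi ↦
          Function.update_of_ne (fun h : i = i₀ ↦ hi₀ (h ▸ hi)) w₀ w]
      exact hwsum
    · intro i hi
      rcases Finset.mem_insert.mp hi with rfl | hi'
      · rw [Function.update_self]
        refine ⟨hw₀K, fun j hj ↦ ?_⟩
        rcases Finset.mem_insert.mp hj with rfl | hj'
        · exact hw₀H₀
        · exact hw₀H j hj'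
      · have hne : i ≠ i₀ := fun h ↦ hi₀ (h ▸ hi')
        rw [Function.update_of_ne hne]
        obtain ⟨hK, hH₀, hH⟩ := hw i hi'
        refine ⟨hK, fun j hj ↦ ?_⟩
        rcases Finset.mem_insert.mp hj with rfl | hj'
        · exact hH₀
        · exact hH j hj'

/-- **Carlton's lemma for an arbitrary representation** (Diamond–Shurman Prop. 5.7.7 / (5.18),
there for irreducible representations of a product of finite groups; here for any linear action
`ρ : G →* End V` in characteristic zero, with `ρ(H i ⊔ K i)` finite and `ρ(H i ⊔ K i)`,
`ρ(H j ⊔ K j)` commuting for `i ≠ j`):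
`V^{⨆ᵢ H i} ⊓ ⨆ᵢ V^{K i} ≤ ⨆ᵢ V^{K i ⊔ ⨆ⱼ H j}`. [cite: DiamondShurman2005, Prop. 5.7.7] -/
theorem fixedSubmodule_inf_iSup_le (ρ : G →* Module.End F V) {ι : Type*}
    (H K : ι → Subgroup G) (hfin : ∀ i, (ρ '' ((H i ⊔ K i : Subgroup G) : Set G)).Finite)
    (hcomm : Pairwise fun i j ↦ ∀ x ∈ H i ⊔ K i, ∀ y ∈ H j ⊔ K j, Commute (ρ x) (ρ y))
    (s : Finset ι) :
    Literature.NumberTheory.GaloisRepresentations.Representation.fixedSubmodule ρ (⨆ i ∈ s, H i) ⊓ (⨆ i ∈ s, Literature.NumberTheory.GaloisRepresentations.Representation.fixedSubmodule ρ (K i)) ≤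
      ⨆ i ∈ s, Literature.NumberTheory.GaloisRepresentations.Representation.fixedSubmodule ρ (K i ⊔ ⨆ j ∈ s, H j) := by
  classical
  intro v hv
  obtain ⟨hvH, hvK⟩ := Submodule.mem_inf.mp hv
  rw [mem_fixedSubmodule_biSup_iff] at hvH
  obtain ⟨μ, hμ⟩ := (Submodule.mem_iSup_finset_iff_exists_sum _ v).mp hvK
  obtain ⟨w, hwsum, hw⟩ := exists_sum_eq_of_mem_fixedSubmodule ρ H K hfin hcomm s v
    (fun i ↦ (μ i : V)) hvH (fun i _ ↦ (μ i).2) hμ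
  have hw' : ∀ i ∈ s, w i ∈ Literature.NumberTheory.GaloisRepresentations.Representation.fixedSubmodule ρ (K i ⊔ ⨆ j ∈ s, H j) := fun i hi ↦ by
    rw [fixedSubmodule_sup, Submodule.mem_inf, mem_fixedSubmodule_biSup_iff]
    exact hw i hi
  refine (Submodule.mem_iSup_finset_iff_exists_sum _ v).mpr
    ⟨fun i ↦ if hi : i ∈ s then ⟨w i, hw' i hi⟩ else 0, ?_⟩
  rw [← hwsum]
  exact Finset.sum_congr rfl fun i hi ↦ by simp [dif_pos hi]

/-- **Carlton's lemma for an arbitrary representation, equality form**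
(Diamond–Shurman (5.18)): `V^{⨆ᵢ H i} ⊓ ⨆ᵢ V^{K i} = ⨆ᵢ V^{K i ⊔ ⨆ⱼ H j}`. [cite: DiamondShurman2005, Prop. 5.7.7] -/
theorem fixedSubmodule_inf_iSup_eq (ρ : G →* Module.End F V) {ι : Type*}
    (H K : ι → Subgroup G) (hfin : ∀ i, (ρ '' ((H i ⊔ K i : Subgroup G) : Set G)).Finite)
    (hcomm : Pairwise fun i j ↦ ∀ x ∈ H i ⊔ K i, ∀ y ∈ H j ⊔ K j, Commute (ρ x) (ρ y))
    (s : Finset ι) :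
    Literature.NumberTheory.GaloisRepresentations.Representation.fixedSubmodule ρ (⨆ i ∈ s, H i) ⊓ (⨆ i ∈ s, Literature.NumberTheory.GaloisRepresentations.Representation.fixedSubmodule ρ (K i)) =
      ⨆ i ∈ s, Literature.NumberTheory.GaloisRepresentations.Representation.fixedSubmodule ρ (K i ⊔ ⨆ j ∈ s, H j) := by
  refine le_antisymm (fixedSubmodule_inf_iSup_le ρ H K hfin hcomm s) ?_
  refine iSup₂_le fun i hi ↦ le_inf ?_ ?_
  · exact fixedSubmodule_antitone ρ le_sup_right
  · exact (fixedSubmodule_antitone ρ le_sup_left).trans (le_biSup (fun i ↦ Literature.NumberTheory.GaloisRepresentations.Representation.fixedSubmodule ρ (K i)) hi)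

/-- **Carlton's lemma for an arbitrary representation of a finite group**
(Diamond–Shurman Prop. 5.7.7 / (5.18) with `G = ∏ Gᵢ` replaced by any finite group and
pairwise commuting `H i ⊔ K i`). [cite: DiamondShurman2005, Prop. 5.7.7] -/
theorem fixedSubmodule_inf_iSup_eq_of_finite [Finite G] (ρ : G →* Module.End F V) {ι : Type*}
    (H K : ι → Subgroup G)
    (hcomm : Pairwise fun i j ↦ ∀ x ∈ H i ⊔ K i, ∀ y ∈ H j ⊔ K j, Commute (ρ x) (ρ y))
    (s : Finset ι) :
    Literature.NumberTheory.GaloisRepresentations.Representation.fixedSubmodule ρ (⨆ i ∈ s, H i) ⊓ (⨆ i ∈ s, Literature.NumberTheory.GaloisRepresentations.Representation.fixedSubmodule ρ (K i)) =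
      ⨆ i ∈ s, Literature.NumberTheory.GaloisRepresentations.Representation.fixedSubmodule ρ (K i ⊔ ⨆ j ∈ s, H j) :=
  fixedSubmodule_inf_iSup_eq ρ H K
    (fun _ ↦ (Set.finite_range ρ).subset (Set.image_subset_range _ _)) hcomm s

end Core

end Literature.RepresentationTheory.FiniteGroups.Representation
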